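import Literature.NumberTheory.EllipticCurves.NoConductorOneDiophantine
import Literature.NumberTheory.EllipticCurves.GlobalMinimalModel
import Literature.NumberTheory.EllipticCurves.SerreOpenImageOrdinaryInertiaProofs
import Literature.NumberTheory.EllipticCurves.RootNumberProofs
import Literature.NumberTheory.DiophantineGeometry.ConductorFactorizationProofs
import Literature.NumberTheory.DiophantineGeometry.ConductorExponentZeroProofs
import HarnessLib

/-!
# No elliptic curve over `ℚ` has everywhere good reduction (Tate) — part 2: Weierstrass models and the conductor

THEOREMS (no named fact, no `sorry`):

* `WeierstrassCurve.Δ_ne_one_and_ne_neg_one_int` — an integral Weierstrass equation over `ℤ` never has `Δ = ±1`.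
  Proof (Silverman, AEC Exercise 8.15): if `a₁` is even then `Δ ≡ −27b₆² (mod 8)` with `b₆ = a₃² + 4a₆`, i.e.
  `Δ ≡ 0` or `5 (mod 8)`, never `±1`; so `a₁` is odd, hence `c₄ = b₂² − 24b₄` is odd, and `3 ∣ c₄ ⇒ 3 ∣ b₂ ⇒ 27 ∣ c₆`;
  now `c₄³ − c₆² = 1728Δ = ±1728` contradicts part 1 (`Int.no_solution_cubed_sub_sq_eq_1728`).
* `WeierstrassCurve.natAbs_minimalDiscriminantInt_ne_one` — the minimal discriminant of an elliptic curve over `ℚ`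
  (in a global minimal model) is not `±1`.
* `WeierstrassCurve.conductorNorm_ne_one` — **the conductor of an elliptic curve over `ℚ` (global minimal model) is
  not `1`**: `N_E = 1` would make every prime good (`f_p = 0 ⇔` good reduction, tree theorems
  `factorization_conductorNorm_holds`, `conductorExponent_eq_zero_iff_holds`), hence `p ∤ Δ_min` for every `p`
  (`not_dvd_minimalDiscriminantInt_of_hasGoodReductionAtPrime'`), i.e. `Δ_min = ±1`.

Consumer (cell `bsd-rank2`, line `star` of crux E1M, item stmt-BirchSwinnertonDyer-20341): the research stub (★-SymbC)
concludes `∃ β, IsAdmissibleStabData N_W β …`, which silently requires `N_W ≠ 1`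
(`…Theorems.DepletionAtTwo.exists_isAdmissibleStabData_iff`); this file makes that a theorem instead of a print input.

References: J. Silverman, *The Arithmetic of Elliptic Curves*, GTM 106 (2009), Exercise 8.15 and VII.5, VIII.8
[SilvermanAEC2009]; J. Tate, *The arithmetic of elliptic curves*, Invent. Math. 23 (1974) §5 [Tate1974];
A. Ogg, *Abelian curves of 2-power conductor*, Proc. Camb. Phil. Soc. 62 (1966) [folklore attribution].
-/

noncomputable section

open scoped Classical

namespace WeierstrassCurve

/-! ## Integral models: `Δ ≠ ±1` -/

section IntModel

variable (W : WeierstrassCurve ℤ)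

/-- If `a₁` is even then `Δ + 27·b₆² ≡ 0 (mod 8)` (`b₂ ≡ 0 (mod 4)`, `b₄` even).
[cite: SilvermanAEC2009, Exercise 8.15 (a)] -/
theorem exists_Δ_add_eq_eight_mul_of_even_a₁ (h : Even W.a₁) : ∃ K : ℤ, W.Δ + 27 * W.b₆ ^ 2 = 8 * K := by
  obtain ⟨k, hk⟩ := h
  refine ⟨-2 * (k ^ 2 + W.a₂) ^ 2 * W.b₈ - 8 * (W.a₄ + k * W.a₃) ^ 3 +
    9 * (k ^ 2 + W.a₂) * (W.a₄ + k * W.a₃) * W.b₆, ?_⟩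
  simp only [WeierstrassCurve.Δ, WeierstrassCurve.b₂, WeierstrassCurve.b₄, hk]
  ring

/-- **`a₁` is odd on an integral model with `Δ = ±1`.** [cite: SilvermanAEC2009, Exercise 8.15 (a)] -/
theorem odd_a₁_of_Δ_eq {σ : ℤ} (hσ : σ = 1 ∨ σ = -1) (hΔ : W.Δ = σ) : Odd W.a₁ := by
  rcases Int.even_or_odd W.a₁ with he | ho
  · exfalso
    obtain ⟨K, hK⟩ := W.exists_Δ_add_eq_eight_mul_of_even_a₁ he
    have hb₆ : W.b₆ = W.a₃ ^ 2 + 4 * W.a₆ := rfl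
    rcases Int.even_or_odd W.a₃ with ⟨j, hj⟩ | ⟨j, hj⟩
    · -- `a₃` even: `b₆ = 4(j² + a₆)`, so `8 ∣ Δ`
      have h16 : W.b₆ ^ 2 = 16 * (j ^ 2 + W.a₆) ^ 2 := by rw [hb₆, hj]; ring
      generalize hM : (j ^ 2 + W.a₆) ^ 2 = M at h16
      rcases hσ with rfl | rfl <;> omega
    · -- `a₃` odd: `b₆ = 4e + 1`, `b₆² = 8·(…) + 1`, so `Δ ≡ −27 ≡ 5 (mod 8)`
      obtain ⟨m, hm⟩ := Int.even_mul_succ_self j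
      have h1 : W.b₆ ^ 2 = 8 * (2 * (j * (j + 1) + W.a₆) ^ 2 + (j * (j + 1) + W.a₆)) + 1 := by
        rw [hb₆, hj]; ring
      rw [hm] at h1
      generalize hM : 2 * (m + m + W.a₆) ^ 2 + (m + m + W.a₆) = M at h1
      rcases hσ with rfl | rfl <;> omega
  · exact ho

/-- **`c₄` is odd when `a₁` is odd** (`b₂` odd, `c₄ = b₂² − 24b₄`). [cite: SilvermanAEC2009, Exercise 8.15 (a)] -/
theorem odd_c₄_int_of_odd_a₁ (h : Odd W.a₁) : Odd W.c₄ := by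
  obtain ⟨k, hk⟩ := h
  have hc₄ : W.c₄ = W.b₂ ^ 2 - 24 * W.b₄ := rfl
  have hb₂ : W.b₂ = 2 * (2 * k ^ 2 + 2 * k + 2 * W.a₂) + 1 := by
    simp only [WeierstrassCurve.b₂, hk]; ring
  set u := 2 * k ^ 2 + 2 * k + 2 * W.a₂ with hu
  refine ⟨2 * u ^ 2 + 2 * u - 12 * W.b₄, ?_⟩
  rw [hc₄, hb₂]; ring

/-- **`3 ∣ c₄ ⇒ 27 ∣ c₆`** (`c₄ ≡ b₂² (mod 3)`, and `b₂ = 3m` gives `c₆ = 27(−m³ + 4mb₄ − 8b₆)`).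
[cite: SilvermanAEC2009, Exercise 8.15 (b)] -/
theorem dvd_c₆_of_three_dvd_c₄ (h : (3 : ℤ) ∣ W.c₄) : (27 : ℤ) ∣ W.c₆ := by
  have hc₄ : W.c₄ = W.b₂ ^ 2 - 24 * W.b₄ := rfl
  have hc₆ : W.c₆ = -W.b₂ ^ 3 + 36 * W.b₂ * W.b₄ - 216 * W.b₆ := rfl
  have h3b : (3 : ℤ) ∣ W.b₂ ^ 2 := by
    have : W.b₂ ^ 2 = W.c₄ + 3 * (8 * W.b₄) := by rw [hc₄]; ring
    rw [this]; exact dvd_add h (dvd_mul_right 3 _)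
  obtain ⟨m, hm⟩ := Int.prime_three.dvd_of_dvd_pow h3b
  exact ⟨-m ^ 3 + 4 * m * W.b₄ - 8 * W.b₆, by rw [hc₆, hm]; ring⟩

/-- **An integral Weierstrass equation over `ℤ` never has discriminant `±1`** (the heart of «no elliptic curve over `ℚ`
has everywhere good reduction»). [cite: SilvermanAEC2009, Exercise 8.15] -/
theorem Δ_ne_of_int {σ : ℤ} (hσ : σ = 1 ∨ σ = -1) : W.Δ ≠ σ := by
  intro hΔ
  have hodd : Odd W.c₄ := W.odd_c₄_int_of_odd_a₁ (W.odd_a₁_of_Δ_eq hσ hΔ)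
  refine Int.no_solution_cubed_sub_sq_eq_1728 W.c₄ W.c₆ σ hσ hodd W.dvd_c₆_of_three_dvd_c₄ ?_
  have := W.c_relation
  rw [hΔ] at this
  linear_combination -this

/-- `Δ ≠ 1` and `Δ ≠ −1` for every integral Weierstrass equation over `ℤ`. [cite: SilvermanAEC2009, Exercise 8.15] -/
theorem Δ_ne_one_and_ne_neg_one_int : W.Δ ≠ 1 ∧ W.Δ ≠ -1 :=
  ⟨W.Δ_ne_of_int (Or.inl rfl), W.Δ_ne_of_int (Or.inr rfl)⟩

end IntModel

/-! ## Over `ℚ`: minimal discriminant and conductor -/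

section Rational

open IsDedekindDomain Literature.NumberTheory.EllipticCurves

variable (W : WeierstrassCurve ℚ) [W.IsElliptic] [W.IsGloballyMinimal]

omit [W.IsElliptic] in
/-- **The minimal discriminant of an elliptic curve over `ℚ` is not `±1`** (global minimal model: `Δ_min` is the
discriminant of the integer model `integralModelInt W`). [cite: SilvermanAEC2009, Exercise 8.15 with VIII.8] -/
theorem natAbs_minimalDiscriminantInt_ne_one : (minimalDiscriminantInt W).natAbs ≠ 1 := by
  intro h
  have h' : (integralModelInt W).Δ = 1 ∨ (integralModelInt W).Δ = -1 := by
    have := Int.natAbs_eq_iff.mp h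
    simpa [minimalDiscriminantInt] using this
  rcases h' with h1 | h1
  · exact (Δ_ne_one_and_ne_neg_one_int (integralModelInt W)).1 h1
  · exact (Δ_ne_one_and_ne_neg_one_int (integralModelInt W)).2 h1

omit [W.IsGloballyMinimal] in
/-- A prime not dividing the conductor is a prime of good reduction (`N_E = ∏ ℓ^{f_ℓ}`, `f_ℓ = 0 ⇔` good reduction;
tree theorems `factorization_conductorNorm_holds`, `conductorExponent_eq_zero_iff_holds`,
`hasGoodReductionAtPrime_iff_hasGoodReductionAt_holds` — light re-derivation of
`Literature.NumberTheory.EllipticCurves.hasGoodReductionAtPrime_of_not_dvd_conductorNorm`).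
[cite: Silverman1994, IV.10.2(a)] -/
theorem hasGoodReductionAtPrime_of_not_dvd_conductorNorm' {ℓ : ℕ} [hℓ : Fact ℓ.Prime]
    (h : ¬ ℓ ∣ W.conductorNorm ℤ) : W.HasGoodReductionAtPrime ℓ := by
  set v : HeightOneSpectrum ℤ := (Rat.HeightOneSpectrum.primesEquiv (R := ℤ)).symm ⟨ℓ, hℓ.out⟩ with hv
  have hgen : Rat.HeightOneSpectrum.natGenerator v = ℓ :=
    congrArg Subtype.val ((Rat.HeightOneSpectrum.primesEquiv (R := ℤ)).apply_symm_apply ⟨ℓ, hℓ.out⟩)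
  have hfac : (W.conductorNorm ℤ).factorization ℓ = 0 := Nat.factorization_eq_zero_of_not_dvd h
  have hf : W.conductorExponent v = 0 := by
    rw [← W.factorization_conductorNorm_holds v, hgen, hfac]
  have hgood' : W.HasGoodReductionAt v := (WeierstrassCurve.conductorExponent_eq_zero_iff_holds v W).mp hf
  exact (W.hasGoodReductionAtPrime_iff_hasGoodReductionAt_holds ⟨ℓ, hℓ.out⟩).mpr hgood'

/-- **The conductor of an elliptic curve over `ℚ` is not `1`** (no elliptic curve over `ℚ` has everywhere good
reduction — Tate): in a global minimal model, `N_E = 1` would give good reduction at every prime, hence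
`p ∤ Δ_min` for all `p`, i.e. `|Δ_min| = 1`, contradicting `natAbs_minimalDiscriminantInt_ne_one`.
[cite: SilvermanAEC2009, Exercise 8.15] [cite: Tate1974, §5] -/
theorem conductorNorm_ne_one : W.conductorNorm ℤ ≠ 1 := by
  intro h1
  refine natAbs_minimalDiscriminantInt_ne_one W (Nat.eq_one_iff_not_exists_prime_dvd.mpr fun p hp hpd ↦ ?_)
  haveI := Fact.mk hp
  have hgood : W.HasGoodReductionAtPrime p :=
    hasGoodReductionAtPrime_of_not_dvd_conductorNorm' W (by rw [h1]; exact hp.not_dvd_one)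
  exact not_dvd_minimalDiscriminantInt_of_hasGoodReductionAtPrime' W p hgood (Int.natCast_dvd.mpr hpd)

/-- Habitat-style corollary for the line `star` (crux E1M): a globally minimal elliptic curve over `ℚ` with ANY extra
hypotheses has `N_W ≠ 1`; in particular the level condition `N_W ≠ 1` inside the `∃ β`-conclusion of (★-SymbC) is
unconditional. [cite: SilvermanAEC2009, Exercise 8.15] -/
theorem one_lt_conductorNorm (hpos : 0 < W.conductorNorm ℤ) : 1 < W.conductorNorm ℤ :=
  lt_of_le_of_ne hpos (Ne.symm (conductorNorm_ne_one W))

end Rational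

end WeierstrassCurve

end
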